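import Literature.RingTheory.Nullstellensatz.PerronSharpDegreeBound
import Mathlib.RingTheory.MvPolynomial.Basic
import Mathlib.RingTheory.MvPolynomial.Homogeneous
import Mathlib.Algebra.MvPolynomial.CommRing
import Mathlib.Algebra.MvPolynomial.Degrees
import Mathlib.Algebra.MvPolynomial.Equiv
import Mathlib.Data.Finsupp.Weight
import Mathlib.Data.Fintype.BigOperators
import Mathlib.RingTheory.Finiteness.Nakayama
import Mathlib.Algebra.Polynomial.Div
import Mathlib.Algebra.Polynomial.RingDivision
import Mathlib.Algebra.Polynomial.Degree.Lemmas
import Mathlib.LinearAlgebra.Matrix.Charpoly.Coeff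
import Mathlib.LinearAlgebra.Matrix.Determinant.Basic
import Mathlib.LinearAlgebra.Matrix.ToLinearEquiv
import Mathlib.RingTheory.Polynomial.Basic
import Mathlib.RingTheory.MvPolynomial
import HarnessLib

/-!
# Perron's theorem, sharp form — PROOF (discharge of `perronTheorem_sharp`)

This file proves the named fact `Literature.RingTheory.Nullstellensatz.perronTheorem_sharp`
(file `PerronSharpDegreeBound`): for polynomials `f_0, …, f_n ∈ K[x_1, …, x_n]` over a field `K`
of degrees `δ_j ≥ 1` there is a non-zero `F ∈ K[y_0, …, y_n]` with `F(f_0, …, f_n) = 0` and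
`deg F · min δ_j ≤ ∏ δ_j` [BeeckenMittmannSaxena2013, Thm. 4 (Perron's theorem); Ploski2005,
Thm. 1.1; Perron1927, Satz 57].  In fact we prove Płoski's WEIGHTED form
(`PerronSharp.exists_algRelation_weighted`): every monomial `y^s` of `F` has weight
`Σ_j δ_j s_j ≤ ∏_j δ_j`; the printed bound follows at once (`perronTheorem_sharp_holds`).

## The proof (elementary; NOT the printed one)

The printed proofs ([Ploski2005], [Jelonek2005], D'Andrea–Krick–Sombra 2013 §3.1) obtain the
weighted bound from Bézout-type degree theory (`[K(x) : K(f)] ≤ ∏ δ_j`, resp. the degree of the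
graph of `f`), which the tree does not have.  We give instead a self-contained argument by
DEFORMATION TO PURE POWERS + the DETERMINANT TRICK, all of whose ingredients are in Mathlib:

1. *Pure-power generation* (`rep_monomial_purePower`, a division algorithm). If
   `H_i = x_i^{d_i} + (terms of degree < d_i)` (`i = 1..n`), every monomial `x^m` is an
   `L`-combination of products `H^b · x^a` over the BOX `a_i < d_i` with `⟨d, b⟩ + |a| ≤ |m|`
   (strong induction on `|m|`: `m = d ∘ b + a`, and `H^b x^a = x^m +` lower terms —
   `leading_mul/pow/prod`).
2. *Deformation and generic generation* (`exists_deformation`, `exists_rho_rep`). Over `R = K[t]`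
   put `G_i = f_i + t · (x_i^{d_i} - f_i^{(d_i)})` (`f^{(d)}` = homogeneous component): `G_i`
   has degree `≤ d_i`, specialises to `f_i` at `t = 0` and to a pure-power `H_i` at `t = 1`.
   Let `M_e ⊆ R[x]` be the `R`-module of sums `Σ_a q_a(G) x^a` (`a` in the box,
   `⟨d, b⟩ + |a| ≤ e` on every monomial `y^b` of `q_a`) and `W_e = R[x]_{≤ e}`.  Step 1 at `t = 1`
   gives `W_e ≤ M_e + (t - 1) • W_e`, so NAKAYAMA's lemma
   (`Submodule.exists_sub_one_mem_and_smul_eq_zero_of_fg_of_le_smul`, ideal `(t - 1)`, module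
   `W_e / (W_e ∩ M_e)`) yields `ρ_e ∈ K[t]` with `ρ_e(1) = 1` and `ρ_e · W_e ≤ M_e`.
3. *Determinant trick* (`exists_mulMatrix`, `exists_relation_deformed`). With
   `N = ∏_{i ≥ 1} d_i` box monomials `x^a` and `Δ = ∏_a ρ_{d_0 + |a|} ≠ 0` one gets
   `Δ · f_0 · x^a = Σ_{a'} C_{a a'}(G) x^{a'}` with `⟨d, b⟩ + |a'| ≤ d_0 + |a|` on the monomials of
   `C_{a a'}`; hence the matrix `Δ f_0 · 1 - C(G)` kills the non-zero vector `(x^a)_a`, so its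
   determinant vanishes (`Matrix.exists_mulVec_eq_zero_iff`).  The FORMAL determinant
   `P = det (Δ y_0 · 1 - C(y_1, …, y_n)) ∈ K[t][y_0, …, y_n]` therefore satisfies `P(f_0, G) = 0`;
   it is non-zero because under `MvPolynomial.finSuccEquiv` it is the characteristic polynomial
   of `C` composed with `Δ X` (`det_scalar_sub_rename_ne_zero`); and a permutation-expansion
   count (`weight_det_le`) bounds the weight of each of its monomials by `N · d_0 = ∏ d_j`.
4. *Specialisation* (`exists_specialization`). Dividing `P` by the exact power of `t` it
   contains and setting `t = 0` gives `F ≠ 0` over `K` with `F(f) = 0` and the same support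
   bound.

Everything is proved; no new definitions, no new facts (D-0026).  Consumers: the positive-
characteristic clause of the Jacobian criterion (`ForbesShpilkaVolk2018_fact51_of_perron`,
`…lemma52/53_of_perron`, `FSV2018_thm9_sparseTrdeg_of_perron`, `FSV2018_thm9_of_fourFacts_of_perron`
in `Literature/Computability/AlgebraicComplexity/`) become unconditional by feeding
`perronTheorem_sharp_holds`.

## References
* [BeeckenMittmannSaxena2013] M. Beecken, J. Mittmann, N. Saxena, *Algebraic independence and
  blackbox identity testing*, Inform. and Comput. 222 (2013), Thm. 4 (arXiv:1102.2789 p. 5).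
* [Ploski2005] A. Płoski, *Algebraic dependence of polynomials after O. Perron and some
  applications*, in: Computational Commutative and Non-Commutative Algebraic Geometry, IOS Press
  (2005), 167–173, Thm. 1.1.
* [Perron1927] O. Perron, *Algebra I (Die Grundlagen)*, de Gruyter (1927), Satz 57.
* [Jelonek2005] Z. Jelonek, *On the effective Nullstellensatz*, Invent. Math. 162 (2005).
-/

noncomputable section

open MvPolynomial

open scoped Pointwise

namespace Literature.RingTheory.Nullstellensatz

namespace PerronSharp

/-! ### Degrees of monomials and leading monomials -/

section leading

variable {L : Type*} [CommRing L] {σ : Type*}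

/-- `degree s = Σ s i` is the quantity `s.sum fun _ e => e` used by `MvPolynomial.totalDegree`.
[folklore] -/
private theorem degree_eq_sum_id (s : σ →₀ ℕ) : s.degree = s.sum fun _ e => e := rfl

/-- Every monomial of `p` has degree `≤ totalDegree p`. [folklore] -/
private theorem degree_le_totalDegree {p : MvPolynomial σ L} {s : σ →₀ ℕ} (hs : s ∈ p.support) :
    s.degree ≤ p.totalDegree := le_totalDegree hs

/-- `totalDegree p ≤ e` iff every monomial of `p` has degree `≤ e`. [folklore] -/
private theorem totalDegree_le_iff_degree_le {p : MvPolynomial σ L} {e : ℕ} :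
    p.totalDegree ≤ e ↔ ∀ s ∈ p.support, s.degree ≤ e := by
  rw [totalDegree, Finset.sup_le_iff]; rfl

/-! ### Leading monomials: `p = x^α + (terms of smaller degree)` -/

/-- Product rule for "`p = x^α +` lower-degree terms". [folklore] -/
private theorem leading_mul [DecidableEq σ] {p q : MvPolynomial σ L} {α β : σ →₀ ℕ}
    (hp : ∀ s ∈ (p - monomial α 1).support, s.degree < α.degree)
    (hq : ∀ s ∈ (q - monomial β 1).support, s.degree < β.degree) :
    ∀ s ∈ (p * q - monomial (α + β) 1).support, s.degree < (α + β).degree := by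
  intro s hs
  set r := p - monomial α 1 with hr
  set t := q - monomial β 1 with ht
  have hpq : p * q - monomial (α + β) 1 =
      monomial α 1 * t + (r * monomial β 1 + r * t) := by
    have hp' : p = monomial α 1 + r := by rw [hr]; ring
    have hq' : q = monomial β 1 + t := by rw [ht]; ring
    rw [hp', hq', ← mul_one (1 : L), ← monomial_mul]; ring
  rw [hpq] at hs
  have hmon : ∀ (γ : σ →₀ ℕ) (u : MvPolynomial σ L) (δ : σ →₀ ℕ),
      (∀ x ∈ u.support, x.degree < δ.degree) →
      ∀ x ∈ (monomial γ (1 : L) * u).support, x.degree < γ.degree + δ.degree := by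
    intro γ u δ hu x hx
    obtain ⟨y, hy, z, hz, rfl⟩ := Finset.mem_add.mp (support_mul _ _ hx)
    have hy' : y = γ := by
      have := support_monomial_subset hy
      simpa using this
    subst hy'
    rw [map_add]
    exact Nat.add_lt_add_left (hu z hz) _
  rcases Finset.mem_union.mp (support_add hs) with h1 | h23
  · simpa [map_add] using hmon α t β hq s h1
  rcases Finset.mem_union.mp (support_add h23) with h2 | h3
  · rw [mul_comm] at h2
    have := hmon β r α hp s h2
    rw [map_add]; omega
  · obtain ⟨y, hy, z, hz, rfl⟩ := Finset.mem_add.mp (support_mul _ _ h3)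
    rw [map_add, map_add]
    exact Nat.add_lt_add (hp y hy) (hq z hz)

/-- `monomial α 1` itself has leading monomial `x^α`. [folklore] -/
private theorem leading_monomial (α : σ →₀ ℕ) :
    ∀ s ∈ (monomial α (1 : L) - monomial α 1).support, s.degree < α.degree := by
  simp

/-- Power rule for leading monomials. [folklore] -/
private theorem leading_pow [DecidableEq σ] {p : MvPolynomial σ L} {α : σ →₀ ℕ}
    (hp : ∀ s ∈ (p - monomial α 1).support, s.degree < α.degree) (k : ℕ) :
    ∀ s ∈ (p ^ k - monomial (k • α) 1).support, s.degree < (k • α).degree := by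
  induction k with
  | zero => simp
  | succ k ih =>
    rw [pow_succ, succ_nsmul]
    exact leading_mul ih hp

/-- Product-over-a-finset rule for leading monomials. [folklore] -/
private theorem leading_prod [DecidableEq σ] {ι : Type*} (S : Finset ι) {p : ι → MvPolynomial σ L}
    {α : ι → σ →₀ ℕ}
    (hp : ∀ i ∈ S, ∀ s ∈ (p i - monomial (α i) 1).support, s.degree < (α i).degree) :
    ∀ s ∈ ((∏ i ∈ S, p i) - monomial (∑ i ∈ S, α i) 1).support,
      s.degree < (∑ i ∈ S, α i).degree := by
  classical
  induction S using Finset.induction_on with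
  | empty => simp
  | insert i S hi ih =>
    rw [Finset.prod_insert hi, Finset.sum_insert hi]
    exact leading_mul (hp i (Finset.mem_insert_self _ _))
      (ih fun j hj => hp j (Finset.mem_insert_of_mem hj))

end leading

/-! ### Step 1: pure-power generation (division algorithm) -/

section purePower

variable {L : Type*} [CommRing L] {σ : Type*}

variable [Fintype σ] [DecidableEq σ]

omit [DecidableEq σ] in
/-- Weight of a finitely supported function on a finite type, as a plain sum. [folklore] -/
private theorem weight_eq_sum (d : σ → ℕ) (b : σ →₀ ℕ) : Finsupp.weight d b = ∑ i, b i * d i := by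
  rw [Finsupp.weight_apply, Finsupp.sum_fintype _ _ (fun i => by simp)]
  simp

/-- **Pure-power generation (division algorithm).** If `H_i = x_i^{d_i} +` (terms of degree
`< d_i`), every monomial `x^m` is an `L`-combination of products `H^b · x^a` over the box
`a_i < d_i`, with `⟨d, b⟩ + |a| ≤ |m|` for every term used. [folklore] -/
private theorem rep_monomial_purePower (d : σ → ℕ) (hd : ∀ i, 0 < d i) (H : σ → MvPolynomial σ L)
    (hH : ∀ i, ∀ s ∈ (H i - X i ^ d i).support, s.degree < d i) (m : σ →₀ ℕ) :
    ∃ q : (Π i, Fin (d i)) → MvPolynomial σ L,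
      (∀ a, ∀ b ∈ (q a).support, Finsupp.weight d b +
          (Finsupp.equivFunOnFinite.symm fun i => (a i : ℕ)).degree ≤ m.degree) ∧
      monomial m 1 = ∑ a, aeval H (q a) *
          monomial (Finsupp.equivFunOnFinite.symm fun i => (a i : ℕ)) 1 := by
  induction h : m.degree using Nat.strong_induction_on generalizing m with
  | _ N ih =>
  -- representations of all monomials of degree `< N`, as one function
  have ih' : ∀ s : σ →₀ ℕ, ∃ q : (Π i, Fin (d i)) → MvPolynomial σ L, s.degree < N →
      (∀ a, ∀ b ∈ (q a).support, Finsupp.weight d b +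
          (Finsupp.equivFunOnFinite.symm fun i => (a i : ℕ)).degree ≤ s.degree) ∧
      monomial s 1 = ∑ a, aeval H (q a) *
          monomial (Finsupp.equivFunOnFinite.symm fun i => (a i : ℕ)) 1 := by
    intro s
    by_cases hs : s.degree < N
    · obtain ⟨q, hq⟩ := ih s.degree hs s rfl
      exact ⟨q, fun _ => hq⟩
    · exact ⟨0, fun h' => absurd h' hs⟩
  choose Q hQ using ih'
  -- the decomposition `m = d ∘ bb + a`
  let a : Π i, Fin (d i) := fun i => ⟨m i % d i, Nat.mod_lt _ (hd i)⟩
  let bb : σ →₀ ℕ := Finsupp.equivFunOnFinite.symm fun i => m i / d i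
  set top : MvPolynomial σ L := aeval H (monomial bb (1 : L)) *
      monomial (Finsupp.equivFunOnFinite.symm fun i => (a i : ℕ)) 1 with htop
  set r : MvPolynomial σ L := top - monomial m 1 with hr_def
  have hexp : (∑ i, bb i • Finsupp.single i (d i)) +
      (Finsupp.equivFunOnFinite.symm fun i => (a i : ℕ)) = m := by
    ext i
    simp only [Finsupp.coe_add, Pi.add_apply, Finsupp.coe_finsetSum, Finset.sum_apply,
      Finsupp.smul_apply, Finsupp.single_apply, smul_eq_mul, mul_ite, mul_zero,
      Finset.sum_ite_eq', Finset.mem_univ, if_true, Finsupp.coe_equivFunOnFinite_symm, a, bb]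
    exact Nat.div_add_mod' (m i) (d i)
  have hwt : Finsupp.weight d bb +
      (Finsupp.equivFunOnFinite.symm fun i => (a i : ℕ)).degree = m.degree := by
    rw [weight_eq_sum, Finsupp.degree_eq_sum, Finsupp.degree_eq_sum, ← Finset.sum_add_distrib]
    refine Finset.sum_congr rfl fun i _ => ?_
    simp only [Finsupp.coe_equivFunOnFinite_symm, a, bb]
    exact Nat.div_add_mod' (m i) (d i)
  have hr : ∀ s ∈ r.support, s.degree < m.degree := by
    have h1 : ∀ s ∈ (aeval H (monomial bb (1 : L)) -
        monomial (∑ i, bb i • Finsupp.single i (d i)) 1).support,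
        s.degree < (∑ i, bb i • Finsupp.single i (d i)).degree := by
      have : aeval H (monomial bb (1 : L)) = ∏ i, H i ^ bb i := by
        rw [aeval_monomial, map_one, one_mul, Finsupp.prod_fintype _ _ (fun i => pow_zero _)]
      rw [this]
      refine leading_prod Finset.univ fun i _ => ?_
      have := leading_pow (p := H i) (α := Finsupp.single i (d i)) ?_ (bb i)
      · exact this
      · simpa only [X_pow_eq_monomial, Finsupp.degree_single] using hH i
    have h2 := leading_mul h1
      (leading_monomial (L := L) (Finsupp.equivFunOnFinite.symm fun i => (a i : ℕ)))
    rw [hexp] at h2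
    simpa only [hr_def, htop] using h2
  refine ⟨fun a' => (Pi.single a (monomial bb (1 : L)) : (Π i, Fin (d i)) → MvPolynomial σ L) a' -
      ∑ s ∈ r.support, coeff s r • Q s a', ?_, ?_⟩
  · intro a' b hb
    rcases Finset.mem_union.mp (support_sub (σ := σ) _ _ hb) with hb1 | hb2
    · by_cases ha' : a' = a
      · subst ha'
        rw [Pi.single_eq_same] at hb1
        have hb' : b = bb := by simpa using support_monomial_subset hb1
        rw [hb', ← h, hwt]
      · rw [Pi.single_eq_of_ne ha'] at hb1
        simp at hb1
    · obtain ⟨s, hs, hbs⟩ := Finset.mem_biUnion.mp (support_sum hb2)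
      have hb3 := support_smul hbs
      have := (hQ s (h ▸ hr s hs)).1 a' b hb3
      rw [← h]
      exact this.trans (hr s hs).le
  · have hsingle : ∑ a', aeval H
        ((Pi.single a (monomial bb (1 : L)) : (Π i, Fin (d i)) → MvPolynomial σ L) a') *
        monomial (Finsupp.equivFunOnFinite.symm fun i => (a' i : ℕ)) 1 = top := by
      rw [Fintype.sum_eq_single a fun a' ha' => by rw [Pi.single_eq_of_ne ha', map_zero, zero_mul],
        Pi.single_eq_same]
    have hrest : ∑ a', aeval H (∑ s ∈ r.support, coeff s r • Q s a') *
        monomial (Finsupp.equivFunOnFinite.symm fun i => (a' i : ℕ)) 1 = r := by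
      simp_rw [map_sum, map_smul, Finset.sum_mul, smul_mul_assoc]
      rw [Finset.sum_comm]
      conv_rhs => rw [r.as_sum]
      refine Finset.sum_congr rfl fun s hs => ?_
      rw [← Finset.smul_sum, ← (hQ s (h ▸ hr s hs)).2, smul_monomial, smul_eq_mul, mul_one]
    simp_rw [map_sub, sub_mul, Finset.sum_sub_distrib]
    rw [hsingle, hrest, hr_def, sub_sub_cancel]

end purePower

/-! ### Degree bookkeeping for substitutions; division by `t - c` -/

section general

variable {σ τ R : Type*} [CommRing R]

/-- `deg (c · y^b)(G) ≤ ⟨d, b⟩` when `deg G_i ≤ d_i`. [folklore] -/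
private theorem totalDegree_aeval_monomial_le (d : τ → ℕ) (G : τ → MvPolynomial σ R)
    (hG : ∀ i, (G i).totalDegree ≤ d i) (b : τ →₀ ℕ) (c : R) :
    (aeval G (monomial b c)).totalDegree ≤ Finsupp.weight d b := by
  classical
  rw [aeval_monomial, Finsupp.prod, Finsupp.weight_apply, Finsupp.sum, algebraMap_eq]
  refine (totalDegree_mul _ _).trans ?_
  rw [totalDegree_C, zero_add]
  refine (totalDegree_finsetProd _ _).trans (Finset.sum_le_sum fun i _ => ?_)
  refine (totalDegree_pow _ _).trans ?_
  rw [smul_eq_mul]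
  exact Nat.mul_le_mul_left _ (hG i)

/-- Degree bound for a substitution with weights: if `deg G_i ≤ d_i` and every monomial `y^b` of
`p` has `⟨d, b⟩ + |α| ≤ e`, then `deg (p(G) · x^α) ≤ e`. [folklore] -/
private theorem totalDegree_aeval_mul_monomial_le (d : τ → ℕ) (G : τ → MvPolynomial σ R)
    (hG : ∀ i, (G i).totalDegree ≤ d i) (p : MvPolynomial τ R) (α : σ →₀ ℕ) (e : ℕ)
    (hp : ∀ b ∈ p.support, Finsupp.weight d b + α.degree ≤ e) :
    (aeval G p * monomial α 1).totalDegree ≤ e := by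
  classical
  rw [p.as_sum, map_sum, Finset.sum_mul]
  refine totalDegree_finsetSum_le fun b hb => ?_
  refine (totalDegree_mul _ _).trans ?_
  refine (Nat.add_le_add (totalDegree_aeval_monomial_le d G hG b _)
    (totalDegree_monomial_le _ _)).trans ?_
  exact hp b hb

/-- `map φ` commutes with substitution: `φ(p(G)) = (φ p)(φ ∘ G)`. [folklore] -/
private theorem map_aeval_eq {R' : Type*} [CommRing R'] (φ : R →+* R') (G : τ → MvPolynomial σ R)
    (p : MvPolynomial τ R) :
    map φ (aeval G p) = aeval (fun i => map φ (G i)) (map φ p) := by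
  rw [aeval_def, algebraMap_eq, map_eval₂, aeval_def, algebraMap_eq]
  rfl

/-- A polynomial over `R[t]` killed by `t ↦ c` is divisible by `t - c`, coefficientwise, without
enlarging the support. [folklore] -/
private theorem exists_eq_smul_of_map_eval_eq_zero (c : R) (r : MvPolynomial σ (Polynomial R))
    (hr : map (Polynomial.evalRingHom c) r = 0) :
    ∃ w : MvPolynomial σ (Polynomial R),
      r = ((Polynomial.X : Polynomial R) - Polynomial.C c) • w ∧ w.support ⊆ r.support := by
  classical
  refine ⟨∑ s ∈ r.support, monomial s (coeff s r /ₘ (Polynomial.X - Polynomial.C c)), ?_, ?_⟩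
  · refine MvPolynomial.ext _ _ fun s => ?_
    rw [coeff_smul, coeff_sum]
    simp only [coeff_monomial, Finset.sum_ite_eq', smul_eq_mul]
    split_ifs with hs
    · rw [eq_comm, Polynomial.mul_divByMonic_eq_iff_isRoot, Polynomial.IsRoot.def]
      have := congr_arg (coeff s) hr
      rwa [coeff_map, coeff_zero] at this
    · rw [mul_zero]
      exact notMem_support_iff.mp hs
  · intro s hs
    obtain ⟨s', hs', hss'⟩ := Finset.mem_biUnion.mp (support_sum hs)
    have := support_monomial_subset hss'
    rw [Finset.mem_singleton] at this
    rwa [this]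

end general

/-! ### Step 2: generic generation by Nakayama's lemma -/

section nakayama

variable {σ : Type*} [Fintype σ] [DecidableEq σ]

/-- **Generic generation (deformation + Nakayama).** Let `G_i ∈ K[t][x]` have `deg G_i ≤ d_i`
and specialise at `t = 1` to polynomials with pure-power leading forms `x_i^{d_i}`.  Then for
every `e` there is `ρ_e ∈ K[t]` with `ρ_e(1) = 1` such that `ρ_e · p` lies, for every `p` of
degree `≤ e`, in the `K[t][G]`-module spanned by the box monomials `x^a` (`a_i < d_i`), with
degree control `⟨d, b⟩ + |a| ≤ e` on every term used. [folklore] -/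
private theorem exists_rho_rep {K : Type*} [CommRing K] (d : σ → ℕ) (hd : ∀ i, 0 < d i)
    (G : σ → MvPolynomial σ (Polynomial K)) (hG : ∀ i, (G i).totalDegree ≤ d i)
    (hG1 : ∀ i, ∀ s ∈ (map (Polynomial.evalRingHom 1) (G i) - X i ^ d i).support, s.degree < d i)
    (e : ℕ) :
    ∃ ρ : Polynomial K, ρ.eval 1 = 1 ∧ ∀ p : MvPolynomial σ (Polynomial K), p.totalDegree ≤ e →
      ∃ q : (Π i, Fin (d i)) → MvPolynomial σ (Polynomial K),
        (∀ a, ∀ b ∈ (q a).support, Finsupp.weight d b +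
            (Finsupp.equivFunOnFinite.symm fun i => (a i : ℕ)).degree ≤ e) ∧
        ρ • p = ∑ a, aeval G (q a) *
            monomial (Finsupp.equivFunOnFinite.symm fun i => (a i : ℕ)) 1 := by
  classical
  -- the target module `M` and the degree-`≤ e` piece `W`
  let M : Submodule (Polynomial K) (MvPolynomial σ (Polynomial K)) :=
    { carrier := {p | ∃ q : (Π i, Fin (d i)) → MvPolynomial σ (Polynomial K),
        (∀ a, ∀ b ∈ (q a).support, Finsupp.weight d b +
            (Finsupp.equivFunOnFinite.symm fun i => (a i : ℕ)).degree ≤ e) ∧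
        p = ∑ a, aeval G (q a) * monomial (Finsupp.equivFunOnFinite.symm fun i => (a i : ℕ)) 1}
      zero_mem' := ⟨0, by simp, by simp⟩
      add_mem' := by
        rintro p p' ⟨q, hq, rfl⟩ ⟨q', hq', rfl⟩
        refine ⟨q + q', fun a b hb => ?_, ?_⟩
        · rcases Finset.mem_union.mp (support_add hb) with h | h
          · exact hq a b h
          · exact hq' a b h
        · rw [← Finset.sum_add_distrib]
          refine Finset.sum_congr rfl fun a _ => ?_
          rw [Pi.add_apply, map_add, add_mul]
      smul_mem' := by
        rintro c p ⟨q, hq, rfl⟩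
        refine ⟨c • q, fun a b hb => hq a b (support_smul hb), ?_⟩
        rw [Finset.smul_sum]
        refine Finset.sum_congr rfl fun a _ => ?_
        rw [Pi.smul_apply, map_smul, smul_mul_assoc] }
  let W : Submodule (Polynomial K) (MvPolynomial σ (Polynomial K)) :=
    restrictTotalDegree σ (Polynomial K) e
  -- every monomial of degree `≤ e` is in `M` modulo `(t - 1) • W`
  have key : ∀ m : σ →₀ ℕ, m.degree ≤ e →
      ∃ v ∈ M, ∃ w ∈ W, monomial m (1 : Polynomial K) =
        v + ((Polynomial.X : Polynomial K) - Polynomial.C 1) • w := by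
    intro m hm
    obtain ⟨q, hq, hqm⟩ := rep_monomial_purePower d hd
      (fun i => map (Polynomial.evalRingHom 1) (G i)) hG1 m
    set v : MvPolynomial σ (Polynomial K) :=
      ∑ a, aeval G (map Polynomial.C (q a)) *
        monomial (Finsupp.equivFunOnFinite.symm fun i => (a i : ℕ)) 1 with hv
    have hvM : v ∈ M := ⟨fun a => map Polynomial.C (q a),
      fun a b hb => (hq a b (support_map_subset _ _ hb)).trans hm, rfl⟩
    set r : MvPolynomial σ (Polynomial K) := monomial m 1 - v with hr
    have hr1 : map (Polynomial.evalRingHom 1) r = 0 := by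
      rw [hr, map_sub, map_monomial, map_one, hv, map_sum]
      simp_rw [map_mul, map_monomial, map_one, map_aeval_eq, map_map]
      have hcomp : (Polynomial.evalRingHom (1 : K)).comp Polynomial.C = RingHom.id K := by
        ext x; simp
      simp_rw [hcomp, map_id]
      rw [← hqm, sub_self]
    obtain ⟨w, hrw, hwr⟩ := exists_eq_smul_of_map_eval_eq_zero 1 r hr1
    have hrdeg : r.totalDegree ≤ e := by
      rw [hr]
      refine (totalDegree_sub _ _).trans (max_le ((totalDegree_monomial_le _ _).trans hm) ?_)
      rw [hv]
      refine totalDegree_finsetSum_le fun a _ => ?_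
      exact totalDegree_aeval_mul_monomial_le d G hG _ _ e
        fun b hb => (hq a b (support_map_subset _ _ hb)).trans hm
    refine ⟨v, hvM, w, ?_, ?_⟩
    · exact (mem_restrictTotalDegree _ _ _).mpr ((totalDegree_le_of_support_subset hwr).trans hrdeg)
    · rw [← hrw, hr, add_sub_cancel]
  -- Nakayama
  let I : Ideal (Polynomial K) := Ideal.span {(Polynomial.X : Polynomial K) - Polynomial.C 1}
  let N : Submodule (Polynomial K) (MvPolynomial σ (Polynomial K) ⧸ M) := W.map M.mkQ
  have hNfg : N.FG := (Module.Finite.iff_fg.mp inferInstance).map _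
  have hNI : N ≤ I • N := by
    rintro x ⟨w, hw, rfl⟩
    have hW : W ≤ (I • N).comap M.mkQ := by
      change restrictSupport (Polynomial K) _ ≤ _
      rw [restrictSupport_eq_span, Submodule.span_le]
      rintro _ ⟨m, hm, rfl⟩
      obtain ⟨v, hvM, w', hw', hmv⟩ := key m hm
      change M.mkQ (monomial m 1) ∈ I • N
      rw [hmv, map_add, Submodule.mkQ_apply, (Submodule.Quotient.mk_eq_zero M).mpr hvM, zero_add,
        map_smul]
      exact Submodule.smul_mem_smul (Ideal.mem_span_singleton_self _) ⟨w', hw', rfl⟩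
    exact hW hw
  obtain ⟨ρ, hρ1, hρN⟩ :=
    Submodule.exists_sub_one_mem_and_smul_eq_zero_of_fg_of_le_smul I N hNfg hNI
  refine ⟨ρ, ?_, fun p hp => ?_⟩
  · obtain ⟨c, hc⟩ := Ideal.mem_span_singleton.mp hρ1
    have := congr_arg (Polynomial.eval 1) hc
    simp only [Polynomial.eval_sub, Polynomial.eval_one, Polynomial.eval_mul, Polynomial.eval_X,
      Polynomial.eval_C, sub_self, zero_mul] at this
    exact sub_eq_zero.mp this
  · have hpW : p ∈ W := (mem_restrictTotalDegree _ _ _).mpr hp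
    have h0 : M.mkQ (ρ • p) = 0 := by
      rw [map_smul]
      exact hρN _ ⟨p, hpW, rfl⟩
    obtain ⟨q, hq, hqp⟩ : ρ • p ∈ M := (Submodule.Quotient.mk_eq_zero M).mp h0
    exact ⟨q, hq, hqp⟩

end nakayama

/-! ### Step 3a: weighted degree and non-vanishing of the formal determinant -/

section det

variable {τ R : Type*} [CommRing R]

/-- A monomial of a finite product is a sum of monomials of the factors. [folklore] -/
private theorem exists_of_mem_support_prod [DecidableEq τ] {ι : Type*} (S : Finset ι)
    (p : ι → MvPolynomial τ R) {s : τ →₀ ℕ} (hs : s ∈ (∏ i ∈ S, p i).support) :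
    ∃ g : ι → τ →₀ ℕ, (∀ i ∈ S, g i ∈ (p i).support) ∧ s = ∑ i ∈ S, g i := by
  classical
  induction S using Finset.induction_on generalizing s with
  | empty =>
    refine ⟨fun _ => 0, fun i hi => absurd hi (Finset.notMem_empty _), ?_⟩
    rw [Finset.prod_empty] at hs
    have := support_monomial_subset (hs : s ∈ (monomial 0 (1 : R)).support)
    simpa using this
  | insert i S hi ih =>
    rw [Finset.prod_insert hi] at hs
    obtain ⟨y, hy, z, hz, rfl⟩ := Finset.mem_add.mp (support_mul _ _ hs)
    obtain ⟨g, hg, rfl⟩ := ih hz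
    refine ⟨Function.update g i y, fun j hj => ?_, ?_⟩
    · rcases Finset.mem_insert.mp hj with rfl | hj
      · simpa using hy
      · rw [Function.update_of_ne (ne_of_mem_of_not_mem hj hi)]
        exact hg j hj
    · rw [Finset.sum_insert hi, Function.update_self]
      congr 1
      exact Finset.sum_congr rfl fun j hj => by
        rw [Function.update_of_ne (ne_of_mem_of_not_mem hj hi)]

/-- **Weighted degree of a determinant.** If entry `(i, j)` only carries monomials of weight
`≤ k + u_i - u_j`, the determinant only carries monomials of weight `≤ (#ι) · k`. [folklore] -/
private theorem weight_det_le [DecidableEq τ] {ι : Type*} [Fintype ι] [DecidableEq ι] (w : τ → ℕ)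
    (u : ι → ℕ) (k : ℕ) (M : Matrix ι ι (MvPolynomial τ R))
    (hM : ∀ i j, ∀ s ∈ (M i j).support, Finsupp.weight w s + u j ≤ k + u i) :
    ∀ s ∈ M.det.support, Finsupp.weight w s ≤ Fintype.card ι * k := by
  intro s hs
  rw [Matrix.det_apply'] at hs
  obtain ⟨σ, -, hσ⟩ := Finset.mem_biUnion.mp (support_sum hs)
  have hs' : s ∈ (∏ i, M (σ i) i).support := by
    rcases Int.units_eq_one_or (Equiv.Perm.sign σ) with h | h
    · simpa [h] using hσ
    · simp only [h, Units.val_neg, Units.val_one, Int.cast_neg, Int.cast_one, neg_mul, one_mul,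
        support_neg] at hσ
      exact hσ
  obtain ⟨g, hg, rfl⟩ := exists_of_mem_support_prod _ _ hs'
  have h1 : ∑ i, (Finsupp.weight w (g i) + u i) ≤ ∑ i, (k + u (σ i)) :=
    Finset.sum_le_sum fun i _ => hM (σ i) i (g i) (hg i (Finset.mem_univ _))
  rw [Finset.sum_add_distrib, Finset.sum_add_distrib, Finset.sum_const, Finset.card_univ,
    smul_eq_mul, Equiv.sum_comp σ u] at h1
  rw [map_sum]
  omega

end det

section nonvanishing

variable {R : Type*} [CommRing R]

/-- `finSuccEquiv` sends a polynomial in the variables `x_1, …, x_n` (renamed by `Fin.succ`) to a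
constant. [folklore] -/
private theorem finSuccEquiv_rename_succ (n : ℕ) (q : MvPolynomial (Fin n) R) :
    finSuccEquiv R n (rename Fin.succ q) = Polynomial.C q := by
  have : ((finSuccEquiv R n).toAlgHom.comp (rename Fin.succ)) q =
      (Polynomial.CAlgHom :
        MvPolynomial (Fin n) R →ₐ[R] Polynomial (MvPolynomial (Fin n) R)) q := by
    congr 1
    refine algHom_ext fun i => ?_
    simp [finSuccEquiv_X_succ]
  simpa using this

/-- **Non-vanishing of the formal characteristic determinant.** For a square matrix `C'` of
polynomials in `x_1, …, x_n` over a domain and `Δ ≠ 0`, the determinant of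
`Δ x_0 · 1 - C'` (with `C'` renamed into the variables `x_1, …, x_n` of `R[x_0, …, x_n]`) is a
non-zero polynomial: under `finSuccEquiv` it is the characteristic polynomial of `C'` composed
with `Δ X`. [folklore] -/
private theorem det_scalar_sub_rename_ne_zero [IsDomain R] {ι : Type*} [Fintype ι] [DecidableEq ι]
    (n : ℕ) (C' : Matrix ι ι (MvPolynomial (Fin n) R)) (Δ : R) (hΔ : Δ ≠ 0) :
    (Matrix.of fun a a' => (if a = a' then C Δ * X 0 else 0) -
      rename Fin.succ (C' a a') : Matrix ι ι (MvPolynomial (Fin (n + 1)) R)).det ≠ 0 := by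
  set P := (Matrix.of fun a a' => (if a = a' then C Δ * X 0 else 0) -
      rename Fin.succ (C' a a') : Matrix ι ι (MvPolynomial (Fin (n + 1)) R)).det with hP
  intro h0
  have h1 : finSuccEquiv R n P = (Matrix.charpoly C').comp
      (Polynomial.C (C Δ : MvPolynomial (Fin n) R) * Polynomial.X) := by
    rw [hP, AlgEquiv.map_det, Matrix.charpoly, ← Polynomial.coe_compRingHom_apply, RingHom.map_det]
    congr 1
    ext a a' : 1
    simp only [AlgEquiv.mapMatrix_apply, Matrix.map_apply, Matrix.of_apply, map_sub,
      RingHom.mapMatrix_apply, Matrix.charmatrix_apply, Polynomial.coe_compRingHom_apply,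
      Polynomial.C_comp, finSuccEquiv_rename_succ]
    congr 1
    rw [Matrix.diagonal_apply]
    split_ifs with h
    · rw [map_mul, finSuccEquiv_X_zero, Polynomial.X_comp]
      congr 1
      rw [finSuccEquiv_apply, eval₂Hom_C]
      rfl
    · rw [map_zero, Polynomial.zero_comp]
  have h2 : (finSuccEquiv R n P).leadingCoeff ≠ 0 := by
    have hq : (Polynomial.C (C Δ : MvPolynomial (Fin n) R) * Polynomial.X).natDegree ≠ 0 := by
      rw [Polynomial.natDegree_C_mul_X _ (C_ne_zero.mpr hΔ)]; exact one_ne_zero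
    rw [h1, Polynomial.leadingCoeff_comp hq, (Matrix.charpoly_monic C').leadingCoeff, one_mul,
      Polynomial.leadingCoeff_C_mul_X]
    exact pow_ne_zero _ (C_ne_zero.mpr hΔ)
  rw [h0, map_zero, Polynomial.leadingCoeff_zero] at h2
  exact h2 rfl

end nonvanishing

/-! ### Step 4: specialisation `t ↦ 0` -/

section specialization

variable {σ τ R : Type*} [CommRing R]

/-- **Specialisation `t ↦ 0`.** A non-zero relation `P(F) = 0` with coefficients in `R[t]`
(`R` a domain) yields, after dividing `P` by the exact power of `t` it contains and setting
`t = 0`, a non-zero relation over `R` among the specialised polynomials, supported inside the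
support of `P`. [folklore] -/
private theorem exists_specialization [IsDomain R] (F : τ → MvPolynomial σ (Polynomial R))
    (P : MvPolynomial τ (Polynomial R)) (hP : P ≠ 0) (hPF : aeval F P = 0) :
    ∃ P₀ : MvPolynomial τ R, P₀ ≠ 0 ∧ P₀.support ⊆ P.support ∧
      aeval (fun j => map (Polynomial.evalRingHom 0) (F j)) P₀ = 0 := by
  classical
  have hne : P.support.Nonempty := support_nonempty.mpr hP
  obtain ⟨s₀, hs₀, hmin⟩ := Finset.exists_min_image P.support
    (fun s => (coeff s P).natTrailingDegree) hne
  set j₀ := (coeff s₀ P).natTrailingDegree with hj₀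
  have hdvd : ∀ s, (Polynomial.X : Polynomial R) ^ j₀ ∣ coeff s P := by
    intro s
    by_cases hs : s ∈ P.support
    · rw [Polynomial.X_pow_dvd_iff]
      intro k hk
      exact Polynomial.coeff_eq_zero_of_lt_natTrailingDegree (hk.trans_le (hmin s hs))
    · rw [notMem_support_iff.mp hs]; exact dvd_zero _
  -- `P = t^{j₀} • P°`
  set P' : MvPolynomial τ (Polynomial R) :=
    ∑ s ∈ P.support, monomial s (coeff s P /ₘ Polynomial.X ^ j₀) with hP'
  have hcoeff : ∀ s, coeff s P' = coeff s P /ₘ Polynomial.X ^ j₀ := by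
    intro s
    rw [hP', coeff_sum]
    simp only [coeff_monomial, Finset.sum_ite_eq']
    split_ifs with hs
    · rfl
    · rw [notMem_support_iff.mp hs, Polynomial.zero_divByMonic]
  have hPP' : P = (Polynomial.X ^ j₀ : Polynomial R) • P' := by
    refine MvPolynomial.ext _ _ fun s => ?_
    rw [coeff_smul, hcoeff, smul_eq_mul]
    have hmonic : (Polynomial.X ^ j₀ : Polynomial R).Monic := Polynomial.monic_X_pow _
    have := Polynomial.modByMonic_add_div (coeff s P) (Polynomial.X ^ j₀)
    rw [(Polynomial.modByMonic_eq_zero_iff_dvd hmonic).mpr (hdvd s), zero_add] at this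
    exact this.symm
  have hP'F : aeval F P' = 0 := by
    have h := hPF
    rw [hPP', map_smul, smul_eq_C_mul, mul_eq_zero] at h
    rcases h with h | h
    · exact absurd (C_eq_zero.mp h) (pow_ne_zero _ Polynomial.X_ne_zero)
    · exact h
  refine ⟨map (Polynomial.evalRingHom 0) P', ?_, ?_, ?_⟩
  · intro h0
    have h1 := congr_arg (coeff s₀) h0
    rw [coeff_map, coeff_zero, hcoeff, Polynomial.coe_evalRingHom,
      ← Polynomial.coeff_zero_eq_eval_zero] at h1
    have h2 : (coeff s₀ P).coeff j₀ = (coeff s₀ P /ₘ Polynomial.X ^ j₀).coeff 0 := by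
      have := Polynomial.coeff_X_pow_mul (coeff s₀ P /ₘ Polynomial.X ^ j₀) j₀ 0
      rw [zero_add] at this
      rw [← this]
      congr 1
      rw [← smul_eq_mul, ← hcoeff, ← coeff_smul, ← hPP']
    have h3 : (coeff s₀ P).coeff j₀ ≠ 0 := by
      rw [hj₀]
      exact Polynomial.trailingCoeff_nonzero_iff_nonzero.mpr (mem_support_iff.mp hs₀)
    exact h3 (h2.trans h1)
  · refine (support_map_subset _ _).trans ?_
    intro s hs
    rw [hP'] at hs
    obtain ⟨s', hs', hss'⟩ := Finset.mem_biUnion.mp (support_sum hs)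
    have := support_monomial_subset hss'
    rw [Finset.mem_singleton] at this
    rwa [this]
  · rw [← map_aeval_eq, hP'F, map_zero]

end specialization

/-! ### Step 3b: the deformation, the multiplication matrix, the relation over `K[t]` -/

section assembly

variable {σ R : Type*} [CommRing R]

/-- `deg (map φ p) ≤ deg p`. [folklore] -/
private theorem totalDegree_map_le {R' : Type*} [CommRing R'] (φ : R →+* R')
    (p : MvPolynomial σ R) :
    (map φ p).totalDegree ≤ p.totalDegree :=
  Finset.sup_mono (support_map_subset φ p)

end assembly

/-- **The deformation.** `G_i = f_i + t · (x_i^{d_i} - f_i^{(d_i)})` over `K[t]` has degree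
`≤ d_i`, specialises at `t = 1` to a polynomial with leading form `x_i^{d_i}` and at `t = 0` to
`f_i`. [folklore] -/
private theorem exists_deformation {K : Type*} [Field K] {n : ℕ}
    (g : Fin n → MvPolynomial (Fin n) K)
    (d : Fin n → ℕ) (hg : ∀ i, (g i).totalDegree ≤ d i) :
    ∃ G : Fin n → MvPolynomial (Fin n) (Polynomial K),
      (∀ i, (G i).totalDegree ≤ d i) ∧
      (∀ i, ∀ s ∈ (map (Polynomial.evalRingHom 1) (G i) - X i ^ d i).support, s.degree < d i) ∧
      (∀ i, map (Polynomial.evalRingHom 0) (G i) = g i) := by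
  classical
  have hιdeg : ∀ p : MvPolynomial (Fin n) K,
      (map (Polynomial.C : K →+* Polynomial K) p).totalDegree ≤ p.totalDegree :=
    fun p => totalDegree_map_le _ p
  have hudeg : ∀ i, (X i ^ d i - homogeneousComponent (d i) (g i)).totalDegree ≤ d i := by
    intro i
    refine (totalDegree_sub _ _).trans (max_le ?_ ?_)
    · rw [totalDegree_X_pow]
    · exact (homogeneousComponent_isHomogeneous _ _).totalDegree_le
  have hmapι : ∀ (c : K) (p : MvPolynomial (Fin n) K),
      map (Polynomial.evalRingHom c) (map (Polynomial.C : K →+* Polynomial K) p) = p := by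
    intro c p
    rw [map_map]
    have : (Polynomial.evalRingHom c).comp Polynomial.C = RingHom.id K := by ext x; simp
    rw [this, map_id]
  refine ⟨fun i => map (Polynomial.C : K →+* Polynomial K) (g i) + (Polynomial.X : Polynomial K) •
      map (Polynomial.C : K →+* Polynomial K) (X i ^ d i - homogeneousComponent (d i) (g i)),
    fun i => ?_, fun i s hs => ?_, fun i => ?_⟩
  · refine (totalDegree_add _ _).trans (max_le ((hιdeg _).trans (hg i)) ?_)
    exact (totalDegree_smul_le _ _).trans ((hιdeg _).trans (hudeg i))
  · rw [map_add, smul_eq_C_mul, map_mul, map_C, Polynomial.coe_evalRingHom, Polynomial.eval_X,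
      hmapι, hmapι, C_1, one_mul, add_sub, add_sub_right_comm, add_sub_cancel_right,
      mem_support_iff, coeff_sub, coeff_homogeneousComponent] at hs
    split_ifs at hs with h
    · exact absurd (sub_self _) hs
    · rw [sub_zero, ← mem_support_iff] at hs
      exact lt_of_le_of_ne ((le_totalDegree hs).trans (hg i)) h
  · rw [map_add, smul_eq_C_mul, map_mul, map_C, Polynomial.coe_evalRingHom, Polynomial.eval_X,
      hmapι, hmapι, C_0, zero_mul, add_zero]

/-- **The matrix of multiplication by `f_0`, with a common denominator `Δ(t)`.** [folklore] -/
private theorem exists_mulMatrix {K : Type*} [Field K] {n : ℕ} (d : Fin n → ℕ) (hd : ∀ i, 0 < d i)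
    (G : Fin n → MvPolynomial (Fin n) (Polynomial K)) (hG : ∀ i, (G i).totalDegree ≤ d i)
    (hG1 : ∀ i, ∀ s ∈ (map (Polynomial.evalRingHom 1) (G i) - X i ^ d i).support, s.degree < d i)
    (p₀ : MvPolynomial (Fin n) (Polynomial K)) (d₀ : ℕ) (hp₀ : p₀.totalDegree ≤ d₀) :
    ∃ Δ : Polynomial K, Δ ≠ 0 ∧
      ∃ C' : Matrix (Π i, Fin (d i)) (Π i, Fin (d i)) (MvPolynomial (Fin n) (Polynomial K)),
        (∀ a a', ∀ b ∈ (C' a a').support, Finsupp.weight d b +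
            (Finsupp.equivFunOnFinite.symm fun i => (a' i : ℕ)).degree ≤
              d₀ + (Finsupp.equivFunOnFinite.symm fun i => (a i : ℕ)).degree) ∧
        ∀ a, ∑ a', aeval G (C' a a') *
            monomial (Finsupp.equivFunOnFinite.symm fun i => (a' i : ℕ)) 1 =
          Δ • (p₀ * monomial (Finsupp.equivFunOnFinite.symm fun i => (a i : ℕ)) 1) := by
  classical
  choose ρ hρ1 hρ using exists_rho_rep d hd G hG hG1
  have hρ0 : ∀ e, ρ e ≠ 0 := fun e h => by simpa [h] using hρ1 e
  have hrep : ∀ a : (Π i, Fin (d i)), ∃ q : (Π i, Fin (d i)) → MvPolynomial (Fin n) (Polynomial K),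
      (∀ a', ∀ b ∈ (q a').support, Finsupp.weight d b +
          (Finsupp.equivFunOnFinite.symm fun i => (a' i : ℕ)).degree ≤
            d₀ + (Finsupp.equivFunOnFinite.symm fun i => (a i : ℕ)).degree) ∧
      ρ (d₀ + (Finsupp.equivFunOnFinite.symm fun i => (a i : ℕ)).degree) •
          (p₀ * monomial (Finsupp.equivFunOnFinite.symm fun i => (a i : ℕ)) 1) =
        ∑ a', aeval G (q a') * monomial (Finsupp.equivFunOnFinite.symm fun i => (a' i : ℕ)) 1 :=
    fun a => hρ _ _ ((totalDegree_mul _ _).trans (Nat.add_le_add hp₀ (totalDegree_monomial_le _ _)))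
  choose q hq hq' using hrep
  refine ⟨∏ a : (Π i, Fin (d i)),
      ρ (d₀ + (Finsupp.equivFunOnFinite.symm fun i => (a i : ℕ)).degree),
    Finset.prod_ne_zero_iff.mpr fun a _ => hρ0 _,
    fun a a' => (∏ a'' ∈ Finset.univ.erase a,
      ρ (d₀ + (Finsupp.equivFunOnFinite.symm fun i => (a'' i : ℕ)).degree)) • q a a',
    fun a a' b hb => hq a a' b (support_smul hb), fun a => ?_⟩
  simp only [map_smul, smul_mul_assoc, ← Finset.smul_sum]
  rw [← hq' a, smul_smul, Finset.prod_erase_mul _ _ (Finset.mem_univ a)]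

/-- **The determinant step.** From the multiplication matrix: a non-zero `P ∈ K[t][y_0, …, y_n]`
with `P(p₀, G) = 0` and weighted degree `≤ (∏_{i ≥ 1} d_i) · d_0`. [folklore] -/
private theorem exists_relation_deformed {K : Type*} [Field K] {n : ℕ} (d : Fin n → ℕ)
    (G : Fin n → MvPolynomial (Fin n) (Polynomial K)) (p₀ : MvPolynomial (Fin n) (Polynomial K))
    (d₀ : ℕ) (Δ : Polynomial K) (hΔ : Δ ≠ 0)
    (C' : Matrix (Π i, Fin (d i)) (Π i, Fin (d i)) (MvPolynomial (Fin n) (Polynomial K)))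
    (hC' : ∀ a a', ∀ b ∈ (C' a a').support, Finsupp.weight d b +
        (Finsupp.equivFunOnFinite.symm fun i => (a' i : ℕ)).degree ≤
          d₀ + (Finsupp.equivFunOnFinite.symm fun i => (a i : ℕ)).degree)
    (hC'sum : ∀ a, ∑ a', aeval G (C' a a') *
        monomial (Finsupp.equivFunOnFinite.symm fun i => (a' i : ℕ)) 1 =
      Δ • (p₀ * monomial (Finsupp.equivFunOnFinite.symm fun i => (a i : ℕ)) 1))
    (hd : ∀ i, 0 < d i) :
    ∃ P : MvPolynomial (Fin (n + 1)) (Polynomial K), P ≠ 0 ∧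
      aeval (Fin.cases p₀ G : Fin (n + 1) → MvPolynomial (Fin n) (Polynomial K)) P = 0 ∧
      ∀ s ∈ P.support, Finsupp.weight (Fin.cases d₀ d : Fin (n + 1) → ℕ) s ≤
        (∏ i, d i) * d₀ := by
  classical
  set PM : Matrix (Π i, Fin (d i)) (Π i, Fin (d i)) (MvPolynomial (Fin (n + 1)) (Polynomial K)) :=
    Matrix.of fun a a' => (if a = a' then C Δ * X 0 else 0) - rename Fin.succ (C' a a') with hPM
  set F : Fin (n + 1) → MvPolynomial (Fin n) (Polynomial K) := Fin.cases p₀ G with hF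
  have hF0 : F 0 = p₀ := by rw [hF]; rfl
  have hFsucc : (F ∘ Fin.succ) = G := by funext i; rw [Function.comp_apply, hF]; rfl
  have hentry : ∀ a a', aeval F (PM a a') = (if a = a' then Δ • p₀ else 0) - aeval G (C' a a') := by
    intro a a'
    rw [hPM, Matrix.of_apply, map_sub, aeval_rename, hFsucc]
    congr 1
    split_ifs
    · rw [map_mul, aeval_C, aeval_X, smul_eq_C_mul, ← algebraMap_eq, hF0]
    · rw [map_zero]
  refine ⟨PM.det, det_scalar_sub_rename_ne_zero n C' Δ hΔ, ?_, ?_⟩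
  · rw [AlgHom.map_det]
    apply Matrix.exists_mulVec_eq_zero_iff.mp
    refine ⟨fun a => monomial (Finsupp.equivFunOnFinite.symm fun i => (a i : ℕ)) 1, ?_, ?_⟩
    · intro h
      have h1 := congr_fun h (fun i => ⟨0, hd i⟩)
      have h0 : (Finsupp.equivFunOnFinite.symm fun i => ((⟨0, hd i⟩ : Fin (d i)) : ℕ)) =
          (0 : Fin n →₀ ℕ) := by ext i; simp
      rw [h0, Pi.zero_apply, monomial_eq_zero] at h1
      exact one_ne_zero h1
    · funext a
      rw [Pi.zero_apply, Matrix.mulVec, dotProduct]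
      simp only [AlgHom.mapMatrix_apply, Matrix.map_apply, hentry, sub_mul, ite_mul, zero_mul,
        Finset.sum_sub_distrib, Finset.sum_ite_eq, Finset.mem_univ, if_true, hC'sum,
        smul_mul_assoc, sub_self]
  · have hcard : (∏ i, d i) * d₀ = Fintype.card (Π i, Fin (d i)) * d₀ := by
      simp [Fintype.card_pi]
    rw [hcard]
    refine weight_det_le _ (fun a => (Finsupp.equivFunOnFinite.symm fun i => (a i : ℕ)).degree)
      d₀ PM fun a a' s hs => ?_
    rw [hPM, Matrix.of_apply] at hs
    rcases Finset.mem_union.mp (support_sub (σ := Fin (n + 1)) _ _ hs) with h1 | h2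
    · split_ifs at h1 with haa
      · subst haa
        rw [C_mul_X_eq_monomial] at h1
        have := support_monomial_subset h1
        rw [Finset.mem_singleton] at this
        rw [this, Finsupp.weight_single, smul_eq_mul, one_mul, Fin.cases_zero]
      · simp at h1
    · rw [support_rename_of_injective (Fin.succ_injective _)] at h2
      obtain ⟨b, hb, rfl⟩ := Finset.mem_image.mp h2
      have hwt : Finsupp.weight (Fin.cases d₀ d : Fin (n + 1) → ℕ) (Finsupp.mapDomain Fin.succ b) =
          Finsupp.weight d b := by
        simp only [Finsupp.weight_apply]
        rw [Finsupp.sum_mapDomain_index_inj (Fin.succ_injective _)]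
        simp only [Fin.cases_succ]
      rw [hwt]
      exact hC' a a' b hb

/-- **Perron's theorem, weighted form (Płoski).** For `f_0, …, f_n ∈ K[x_1, …, x_n]` of degrees
`δ_j ≥ 1` there is `P ≠ 0` in `K[y_0, …, y_n]` with `P(f) = 0` whose every monomial `y^s` has
weight `Σ δ_j s_j ≤ ∏ δ_j`. [cite: BeeckenMittmannSaxena2013, Thm. 4] -/
theorem exists_algRelation_weighted {K : Type*} [Field K] {n : ℕ}
    (f : Fin (n + 1) → MvPolynomial (Fin n) K) (hf : ∀ j, 0 < (f j).totalDegree) :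
    ∃ P : MvPolynomial (Fin (n + 1)) K, P ≠ 0 ∧ aeval f P = 0 ∧
      ∀ s ∈ P.support, Finsupp.weight (fun j => (f j).totalDegree) s ≤ ∏ j, (f j).totalDegree := by
  classical
  obtain ⟨G, hG, hG1, hG0⟩ := exists_deformation (fun i => f i.succ)
    (fun i => (f i.succ).totalDegree) fun i => le_rfl
  obtain ⟨Δ, hΔ, C', hC', hC'sum⟩ := exists_mulMatrix (fun i => (f i.succ).totalDegree)
    (fun i => hf i.succ) G hG hG1 (map Polynomial.C (f 0)) (f 0).totalDegree
    (totalDegree_map_le _ _)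
  obtain ⟨P, hP0, hPF, hPwt⟩ := exists_relation_deformed _ G _ _ Δ hΔ C' hC' hC'sum
    fun i => hf i.succ
  obtain ⟨P₀, hP₀0, hP₀supp, hP₀F⟩ := exists_specialization _ P hP0 hPF
  have hF0 : (fun j => map (Polynomial.evalRingHom 0)
      ((Fin.cases (map Polynomial.C (f 0)) G : Fin (n + 1) → _) j)) = f := by
    funext j
    refine Fin.cases ?_ (fun i => ?_) j
    · rw [show (Fin.cases (map Polynomial.C (f 0)) G : Fin (n + 1) → _) 0 = map Polynomial.C (f 0)
        from rfl, map_map]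
      have : (Polynomial.evalRingHom (0 : K)).comp Polynomial.C = RingHom.id K := by ext x; simp
      rw [this, map_id]
    · rw [show (Fin.cases (map Polynomial.C (f 0)) G : Fin (n + 1) → _) i.succ = G i from rfl, hG0]
  rw [hF0] at hP₀F
  refine ⟨P₀, hP₀0, hP₀F, fun s hs => ?_⟩
  have h1 := hPwt s (hP₀supp hs)
  have hw : (Fin.cases (f 0).totalDegree (fun i => (f i.succ).totalDegree) : Fin (n + 1) → ℕ) =
      fun j => (f j).totalDegree := by
    funext j; refine Fin.cases ?_ (fun i => ?_) j <;> simp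
  rw [hw] at h1
  rw [Fin.prod_univ_succ, mul_comm]
  exact h1

end PerronSharp

open PerronSharp in
/-- **Perron's theorem (sharp form) — DISCHARGED.** «Let `f_i ∈ K[x_1, …, x_n]` be a polynomial
of degree `δ_i ≥ 1`, for `i ∈ [n+1]`. Then there exists a non-zero polynomial
`F ∈ K[y_1, …, y_{n+1}]` such that `F(f_1, …, f_{n+1}) = 0` and `deg(F) ≤ (∏_i δ_i)/min_i{δ_i}`»
(any field `K`), in the typed form `deg(F) · m ≤ ∏ δ_i` for every common lower bound
`1 ≤ m ≤ δ_i`: immediate from the weighted form `exists_algRelation_weighted`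
(`m · |s| ≤ Σ δ_j s_j ≤ ∏ δ_j` for every monomial `y^s` of `F`).
[cite: BeeckenMittmannSaxena2013, Thm. 4; Ploski2005, Thm. 1.1; Perron1927, Satz 57] -/
theorem perronTheorem_sharp_holds : perronTheorem_sharp := by
  intro K _ n f m hm hmf
  classical
  obtain ⟨P, hP0, hPf, hPwt⟩ := exists_algRelation_weighted f fun j => hm.trans (hmf j)
  refine ⟨P, hP0, hPf, ?_⟩
  rcases P.support.eq_empty_or_nonempty with hP | hP
  · simp [totalDegree, hP]
  · obtain ⟨s, hs, hsup⟩ := Finset.exists_mem_eq_sup P.support hP fun s => s.sum fun _ e => e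
    rw [totalDegree, hsup, ← degree_eq_sum_id, Finsupp.degree_eq_sum, Finset.sum_mul]
    refine le_trans (Finset.sum_le_sum fun i _ => Nat.mul_le_mul_left (s i) (hmf i)) ?_
    rw [← weight_eq_sum]
    exact hPwt s hs

end Literature.RingTheory.Nullstellensatz

end
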